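import Literature.Computability.MetaComplexity.GadgetLift
import Literature.Computability.MetaComplexity.ResLinWinningStrategy
import Literature.Computability.MetaComplexity.ResLinWidth
import Literature.Computability.MetaComplexity.ResLinGaussianWidth
import HarnessLib

/-!
# The converse of width lifting: a lifted CNF is refuted within rank `a·(W+1)`

The (folklore) other direction of Alekseev–Itsykson's width-lifting theorem
(`ResLinWidthLifting.lean`): for EVERY gadget `g : {0,1}^a → {0,1}` and every CNF `φ` with a
resolution refutation of width `≤ W`, the lifted formula `φ ∘ g = gadgetLift a g φ` has a Res(⊕)
refutation all of whose lines have at most `a·(W+1)` linear literals, hence rank-width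
`≤ a·(W+1)` (`exists_isResLinRefutation_gadgetLift_of_resWidth_le`, `minResLinWidth_gadgetLift_le`).
Together with the lifting theorem this pins the Res(⊕) rank of `φ ∘ g`, `g` 1-stifling, between
the resolution width of `φ` and `a` times it (plus `a`): the lifting theorem is tight up to the
block size.

Proof: the standard substitution argument, run inside Res(⊕) with the literal-width-bounded
derivability predicate `ResLinDerivableWithin` (Gryaznov–Ovcharov–Riazanov bookkeeping,
`ResLinWinningStrategy.lean`). Invariant: for every clause `C` of the resolution refutation and
every choice `d` of one clause `d(l) ∈ CNF(l ∘ g)` per literal `l ∈ C`, the linear clause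
`⋃_{l ∈ C} d(l)` is derivable within literal-width `a(W+1)`. Initial clauses: these unions are
(the linear readings of) clauses of `φ ∘ g`. Weakening: monotonicity. A resolution step on `x`
with resolvent `E`: for every pattern `S` of the block of `x`, the canonical clause "block ≠ S"
belongs to `CNF(x ∘ g)` if `g(S) = 0` and to `CNF(¬x ∘ g)` if `g(S) = 1`, so the invariant for the
corresponding premise gives `⋃_{l∈E} d(l) ∨ (block ≠ S)`; resolving out the block along the
complete binary tree (`ResLinDerivableWithin.tree`, `ResLinGaussianWidth.lean`) gives
`⋃_{l∈E} d(l)`. [folklore; cf. Alekseev–Itsykson 2025, §2.6 (definition of `Φ ∘ g`); Garg–Göös–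
Kamath–Sokolov 2018 §2]

## References

* Y. Alekseev, D. Itsykson, STOC 2025 (= ECCC TR24-128), §2.6, Thm 3.1 [AlekseevItsykson2025].
* A. Garg, M. Göös, P. Kamath, D. Sokolov, *Monotone circuit lower bounds from resolution*,
  STOC 2018, §2 (`F ∘ gⁿ`) [GargEtAl2018].
-/

namespace Literature.Computability.MetaComplexity

open _root_.Computability Complexity Finset

section Converse

variable {a : ℕ} {g : (Fin a → Bool) → Bool}

/-! ### Lifted readings of a set-clause -/

/-- The linear clause of a concatenation is the union. [Itsykson–Sokolov 2020, §2]
[cite: ItsyksonSokolov2020, §2] -/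
theorem toLinClause_append (c c' : Clause ℕ) :
    Clause.toLinClause (c ++ c') = Clause.toLinClause c ∪ Clause.toLinClause c' := by
  unfold Clause.toLinClause
  rw [List.map_append, List.toFinset_append]

/-- Concatenating one chosen clause of `CNF(l ∘ g)` per literal of the list-clause `c` gives a
clause of the lift `c ∘ g`. [Alekseev–Itsykson 2025, §2.6 ("`Cᵢ ∘ g` consists of all clauses of
the form `D₁ ∨ ⋯ ∨ D_{nᵢ}` where `D_j` is a clause of `l_{i,j} ∘ g`")] [cite: AlekseevItsykson2025, §2.6] -/
theorem flatten_map_mem_gadgetLiftClause (d : Literal ℕ → Clause ℕ) :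
    ∀ c : Clause ℕ, (∀ l ∈ c, d l ∈ gadgetLiteralCNF a g l) →
      (c.map d).flatten ∈ gadgetLiftClause a g c := by
  intro c
  induction c with
  | nil => intro _; simp [gadgetLiftClause]
  | cons l c ih =>
    intro h
    simp only [gadgetLiftClause, List.mem_flatMap, List.mem_map, List.map_cons, List.flatten_cons]
    exact ⟨d l, h l List.mem_cons_self, (c.map d).flatten,
      ih fun l' hl' => h l' (List.mem_cons_of_mem _ hl'), rfl⟩

/-- The linear clause of that concatenation is the union of the linear clauses of the chosen
clauses over the SET of literals of `c`. [folklore] -/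
theorem toLinClause_flatten_map (d : Literal ℕ → Clause ℕ) :
    ∀ c : Clause ℕ, Clause.toLinClause ((c.map d).flatten) =
      c.toFinset.biUnion fun l => Clause.toLinClause (d l) := by
  intro c
  induction c with
  | nil => simp
  | cons l c ih =>
    rw [List.map_cons, List.flatten_cons, toLinClause_append, ih, List.toFinset_cons,
      Finset.biUnion_insert]

/-- The union of chosen clauses over a set-clause has at most `a·|C|` linear literals. [folklore] -/
theorem card_biUnion_toLinClause_le (d : Literal ℕ → Clause ℕ) (C : Finset (Literal ℕ))
    (hd : ∀ l ∈ C, d l ∈ gadgetLiteralCNF a g l) :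
    (C.biUnion fun l => Clause.toLinClause (d l)).card ≤ a * C.card := by
  calc (C.biUnion fun l => Clause.toLinClause (d l)).card
      ≤ ∑ l ∈ C, (Clause.toLinClause (d l)).card := Finset.card_biUnion_le
    _ ≤ ∑ l ∈ C, a := Finset.sum_le_sum fun l hl =>
        (card_toLinClause_le _).trans (by rw [length_of_mem_gadgetLiteralCNF (hd l hl)])
    _ = a * C.card := by rw [Finset.sum_const, smul_eq_mul, mul_comm]

/-- The canonical clause "block of `x` ≠ `S`" belongs to `CNF((x, b) ∘ g)` exactly when
`g(𝟙_S) ≠ b`. [Alekseev–Itsykson 2025, §2.6; Garg–Göös–Kamath–Sokolov 2018, §2]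
[cite: AlekseevItsykson2025, §2.6] -/
theorem blockClause_mem_gadgetLiteralCNF {x : ℕ} {b : Bool} {S : List ℕ}
    (hS : S ∈ (xorBlock a x).sublists) (hg : g (blockIndicator a x S) ≠ b) :
    ((xorBlock a x).map fun w => (w, decide (w ∉ S))) ∈ gadgetLiteralCNF a g (x, b) := by
  unfold gadgetLiteralCNF
  exact List.mem_map.2 ⟨S, List.mem_filter.2 ⟨hS, by simpa using hg⟩, rfl⟩

/-! ### The simulation -/

/-- **The invariant of the substitution argument.** Let `π` be a resolution refutation of `φ` of
width `≤ W`. For every line `C` of `π` and every choice `d(l) ∈ CNF(l ∘ g)` (`l ∈ C`), the linear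
clause `⋃_{l ∈ C} d(l)` is Res(⊕)-derivable from `φ ∘ g` within literal-width `a·(W+1)`.
[folklore] -/
theorem resLinDerivableWithin_biUnion_of_mem {φ : CNF ℕ} {W : ℕ} {π : List (ResLine ℕ)}
    (hπ : IsResDerivation φ π) (hW : resWidth π ≤ W) :
    ∀ l ∈ π, ∀ d : Literal ℕ → Clause ℕ, (∀ x ∈ l.clause, d x ∈ gadgetLiteralCNF a g x) →
      ResLinDerivableWithin (gadgetLift a g φ) (a * (W + 1))
        (l.clause.biUnion fun x => Clause.toLinClause (d x)) := by
  classical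
  have hwid : ∀ l ∈ π, l.clause.card ≤ W := (resWidth_le_iff).1 hW
  -- strong induction on the position of the line
  suffices key : ∀ n, ∀ i (hi : i < π.length), i < n → ∀ d : Literal ℕ → Clause ℕ,
      (∀ x ∈ (π[i]'hi).clause, d x ∈ gadgetLiteralCNF a g x) →
      ResLinDerivableWithin (gadgetLift a g φ) (a * (W + 1))
        ((π[i]'hi).clause.biUnion fun x => Clause.toLinClause (d x)) by
    intro l hl
    obtain ⟨i, hi, rfl⟩ := List.getElem_of_mem hl
    exact key (i + 1) i hi (Nat.lt_succ_self i)
  intro n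
  induction n with
  | zero => intro i hi hn; exact absurd hn (Nat.not_lt_zero _)
  | succ n ih =>
    intro i hi hin d hd
    have hvalid := hπ i hi
    have hcardW : (π[i]'hi).clause.card ≤ W := hwid _ (List.getElem_mem hi)
    have hK : a * (π[i]'hi).clause.card ≤ a * (W + 1) :=
      Nat.mul_le_mul_left a (hcardW.trans (Nat.le_succ W))
    unfold IsValidResLine at hvalid
    rcases hrule : (π[i]'hi).rule with _ | ⟨p, q, v⟩ | ⟨p⟩
    · -- initial clause `c.toFinset`, `c ∈ φ`: the union is a clause of `φ ∘ g`
      rw [hrule] at hvalid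
      change (π[i]'hi).clause ∈ φ.map List.toFinset at hvalid
      obtain ⟨c, hc, hcl⟩ := List.mem_map.1 hvalid
      have hdc : ∀ x ∈ c, d x ∈ gadgetLiteralCNF a g x := fun x hx =>
        hd x (by rw [← hcl]; exact List.mem_toFinset.2 hx)
      have hmem : (c.map d).flatten ∈ gadgetLift a g φ :=
        List.mem_flatMap.2 ⟨c, hc, flatten_map_mem_gadgetLiftClause d c hdc⟩
      have h := ResLinDerivableWithin.initial (φ := gadgetLift a g φ) (k := a * (W + 1)) _ hmem (by
        rw [toLinClause_flatten_map, hcl]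
        exact (card_biUnion_toLinClause_le d _ hd).trans hK)
      rwa [toLinClause_flatten_map, hcl] at h
    · -- resolvent on `v` of lines `p` (∋ `v`) and `q` (∋ `¬v`)
      rw [hrule] at hvalid
      obtain ⟨hp, hq, hvC, hvD, hE⟩ := hvalid
      rw [List.length_take] at hp hq
      have hp' : p < π.length := lt_of_lt_of_le hp (min_le_right _ _)
      have hq' : q < π.length := lt_of_lt_of_le hq (min_le_right _ _)
      have hpi : p < i := lt_of_lt_of_le hp (min_le_left _ _)
      have hqi : q < i := lt_of_lt_of_le hq (min_le_left _ _)
      simp only [List.getElem_take] at hvC hvD hE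
      set C := (π[p]'hp').clause with hCdef
      set D := (π[q]'hq').clause with hDdef
      set E := (π[i]'hi).clause with hEdef
      set T : LinClause := E.biUnion fun x => Clause.toLinClause (d x) with hTdef
      have hTcard : T.card ≤ a * W := (card_biUnion_toLinClause_le d E hd).trans (Nat.mul_le_mul_left a hcardW)
      -- resolve out the block of `v` along the complete binary tree
      refine ResLinDerivableWithin.tree (xorBlock a v) T (nodup_xorBlock a v)
        (by rw [length_xorBlock]; nlinarith [hTcard]) fun S hS => ?_
      -- the premise to use depends on `g(𝟙_S)`
      have hsub : ∀ (P : Finset (Literal ℕ)) (lit : Literal ℕ), P.erase lit ⊆ E →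
          (lit ∈ P) →
          ((xorBlock a v).map fun w => (w, decide (w ∉ S))) ∈ gadgetLiteralCNF a g lit →
          (∀ d' : Literal ℕ → Clause ℕ, (∀ x ∈ P, d' x ∈ gadgetLiteralCNF a g x) →
            ResLinDerivableWithin (gadgetLift a g φ) (a * (W + 1))
              (P.biUnion fun x => Clause.toLinClause (d' x))) →
          ResLinDerivableWithin (gadgetLift a g φ) (a * (W + 1))
            (T ∪ Clause.toLinClause ((xorBlock a v).map fun w => (w, decide (w ∉ S)))) := by
        intro P lit hPE hlit hblk hIH
        let d' : Literal ℕ → Clause ℕ :=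
          Function.update d lit ((xorBlock a v).map fun w => (w, decide (w ∉ S)))
        have hd' : ∀ x ∈ P, d' x ∈ gadgetLiteralCNF a g x := by
          intro x hx
          by_cases hxl : x = lit
          · subst hxl
            have : d' x = ((xorBlock a v).map fun w => (w, decide (w ∉ S))) := Function.update_self x _ d
            rw [this]; exact hblk
          · have : d' x = d x := Function.update_of_ne hxl _ _
            rw [this]
            exact hd x (hPE (Finset.mem_erase.2 ⟨hxl, hx⟩))
        have hder := hIH d' hd'
        refine .weaken _ _ hder (fun σ hσ => LinClause.eval_mono ?_ hσ) ?_
        · -- `⋃_{x ∈ P} d'(x) ⊆ T ∪ (block ≠ S)`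
          intro y hy
          rw [Finset.mem_biUnion] at hy
          obtain ⟨x, hx, hy⟩ := hy
          by_cases hxl : x = lit
          · subst hxl
            simp only [d', Function.update_self] at hy
            exact Finset.mem_union_right _ hy
          · have : d' x = d x := Function.update_of_ne hxl _ _
            rw [this] at hy
            exact Finset.mem_union_left _
              (Finset.mem_biUnion.2 ⟨x, hPE (Finset.mem_erase.2 ⟨hxl, hx⟩), hy⟩)
        · refine (Finset.card_union_le _ _).trans ?_
          have h2 : (Clause.toLinClause ((xorBlock a v).map fun w => (w, decide (w ∉ S)))).card ≤ a :=
            (card_toLinClause_le _).trans (by rw [List.length_map, length_xorBlock])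
          nlinarith [hTcard, h2]
      by_cases hgS : g (blockIndicator a v S) = true
      · -- `g(𝟙_S) = 1 ≠ 0`: the block clause is in `CNF(¬v ∘ g)`; use the premise `D ∋ ¬v`
        refine hsub D (v, false) (by rw [hE]; exact Finset.subset_union_right) hvD
          (blockClause_mem_gadgetLiteralCNF hS (by rw [hgS]; decide)) ?_
        intro d' hd'
        exact ih q hq' (by omega) d' hd'
      · -- `g(𝟙_S) = 0 ≠ 1`: the block clause is in `CNF(v ∘ g)`; use the premise `C ∋ v`
        refine hsub C (v, true) (by rw [hE]; exact Finset.subset_union_left) hvC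
          (blockClause_mem_gadgetLiteralCNF hS (by simpa using hgS)) ?_
        intro d' hd'
        exact ih p hp' (by omega) d' hd'
    · -- weakening of line `p`: monotonicity
      rw [hrule] at hvalid
      obtain ⟨hp, hsubset⟩ := hvalid
      rw [List.length_take] at hp
      have hp' : p < π.length := lt_of_lt_of_le hp (min_le_right _ _)
      have hpi : p < i := lt_of_lt_of_le hp (min_le_left _ _)
      rw [List.getElem_take] at hsubset
      have hder := ih p hp' (by omega) d fun x hx => hd x (hsubset hx)
      refine .weaken _ _ hder (fun σ hσ => LinClause.eval_mono ?_ hσ)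
        ((card_biUnion_toLinClause_le d _ hd).trans hK)
      exact Finset.biUnion_subset_biUnion_of_subset_left _ hsubset

/-- **Converse of width lifting** (folklore): if `φ` has a resolution refutation of width `≤ W`,
then for every gadget `g : {0,1}^a → {0,1}` the lift `φ ∘ g` has a Res(⊕) refutation all of whose
lines have at most `a·(W+1)` linear literals (so rank-width `≤ a·(W+1)`). No stifling is needed
in this direction. [folklore; cf. Alekseev–Itsykson 2025, Thm 3.1 (the direction proved there is
the converse)] [cite: AlekseevItsykson2025, §2.6] -/
theorem exists_isResLinRefutation_gadgetLift_of_resWidth_le (g : (Fin a → Bool) → Bool)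
    {φ : CNF ℕ} {W : ℕ} {π₀ : List (ResLine ℕ)} (hπ₀ : IsResRefutation φ π₀)
    (hW : resWidth π₀ ≤ W) :
    ∃ π : List ResLinLine, IsResLinRefutation (gadgetLift a g φ) π ∧
      (∀ l ∈ π, l.clause.card ≤ a * (W + 1)) ∧ resLinWidth π ≤ a * (W + 1) := by
  classical
  obtain ⟨hder, l, hl, hlE⟩ := hπ₀
  have h := resLinDerivableWithin_biUnion_of_mem (a := a) (g := g) hder hW l hl (fun _ => [])
    (fun x hx => by rw [hlE] at hx; exact absurd hx (Finset.notMem_empty x))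
  rw [hlE, Finset.biUnion_empty] at h
  obtain ⟨π, hπ, hcard⟩ := h.exists_isResLinRefutation
  refine ⟨π, hπ, hcard, ?_⟩
  rw [resLinWidth_le_iff]
  exact fun l' hl' => (linClauseRank_le_card _).trans (hcard l' hl')

/-- `ℕ∞` form of the converse: `minResLinWidth (φ ∘ g) ≤ a·(W+1)` whenever `φ` has a resolution
refutation of width `≤ W`. [folklore] [cite: AlekseevItsykson2025, §2.6] -/
theorem minResLinWidth_gadgetLift_le (g : (Fin a → Bool) → Bool) {φ : CNF ℕ} {W : ℕ}
    {π₀ : List (ResLine ℕ)} (hπ₀ : IsResRefutation φ π₀) (hW : resWidth π₀ ≤ W) :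
    minResLinWidth (gadgetLift a g φ) ≤ ((a * (W + 1) : ℕ) : ℕ∞) := by
  obtain ⟨π, hπ, -, hw⟩ := exists_isResLinRefutation_gadgetLift_of_resWidth_le g hπ₀ hW
  unfold minResLinWidth
  exact (iInf₂_le π hπ).trans (by exact_mod_cast hw)

end Converse

end Literature.Computability.MetaComplexity
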